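/-
Soloist `solo-ValiantsHypothesis-informed`, session 23 — polynomial sections: the UFD normal form of
bilinear families and neighbourhood independence (note `paper/quadspan.md` §7.17, Proposition 7.77 (a), (c)).
-/
import Mathlib

/-!
# Bilinear monomial families over `K[X]`: common divisors are monomials; neighbours are independent

Setting of the soloist note `paper/quadspan.md` §7.4/§7.17: rows `(f, h)` and columns `(k, g)` with
entries in a fixed finite-dimensional space of polynomials, and EDGES `f * g - h * k = C c * X ^ e`
(`c ≠ 0`), the exponents `e` on the edges at one row pairwise distinct.

* `soloInformed_dvd_X_pow_of_dvd_C_mul_X_pow` : a divisor of `C c * X ^ e` (`c ≠ 0`) is associated to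
  some `X ^ m`, `m ≤ e` (`K[X]` is a UFD and `X` is prime);
* `soloInformed_row_common_divisor_monomial` / `soloInformed_col_common_divisor_monomial` :
  Proposition 7.77(a) — every common divisor of the two entries of an ACTIVE row (column) is a
  monomial up to a unit, i.e. active vectors are `X ^ m •` (coprime pair);
* `soloInformed_neighbours_linearIndependent` : Proposition 7.77(c) — if `f * g j - h * k j = c j • χ j`
  for all `j` with `χ` linearly independent (e.g. distinct powers of the variable) and all `c j ≠ 0`,
  then the columns `j ↦ (k j, g j)` are linearly independent (over any commutative `K`-algebra);
* `soloInformed_neighbours_card_le` : hence at most `2 · finrank K L'` columns are adjacent to one row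
  when all entries lie in a finite-dimensional subspace `L'` — the degree bound `deg_Γ ≤ 2(s+1)`.
-/

namespace Summit.ValiantsHypothesis.ValiantsHypothesis.Theorems

open Polynomial

section UFD

variable {K : Type*} [Field K]

/-- A divisor of `C c * X ^ e`, `c ≠ 0`, is a monomial up to a unit. -/
theorem soloInformed_dvd_X_pow_of_dvd_C_mul_X_pow {q : K[X]} {c : K} {e : ℕ} (hc : c ≠ 0)
    (hq : q ∣ C c * X ^ e) : ∃ m ≤ e, Associated q (X ^ m) := by
  have hu : IsUnit (C c) := Polynomial.isUnit_C.mpr (isUnit_iff_ne_zero.mpr hc)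
  have h2 : q ∣ (X : K[X]) ^ e := hu.dvd_mul_left.mp hq
  exact (dvd_prime_pow Polynomial.prime_X e).mp h2

/-- Proposition 7.77(a), rows: on an edge `f * g - h * k = C c * X ^ e` (`c ≠ 0`) every common
divisor of the row entries `f, h` is associated to a power `X ^ m`, `m ≤ e`. -/
theorem soloInformed_row_common_divisor_monomial {f h k g q : K[X]} {c : K} {e : ℕ} (hc : c ≠ 0)
    (hdet : f * g - h * k = C c * X ^ e) (hf : q ∣ f) (hh : q ∣ h) :
    ∃ m ≤ e, Associated q (X ^ m) := by
  apply soloInformed_dvd_X_pow_of_dvd_C_mul_X_pow hc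
  rw [← hdet]
  exact dvd_sub (hf.mul_right g) (hh.mul_right k)

/-- Proposition 7.77(a), columns: every common divisor of the column entries `k, g` is associated
to a power `X ^ m`, `m ≤ e`. -/
theorem soloInformed_col_common_divisor_monomial {f h k g q : K[X]} {c : K} {e : ℕ} (hc : c ≠ 0)
    (hdet : f * g - h * k = C c * X ^ e) (hk : q ∣ k) (hg : q ∣ g) :
    ∃ m ≤ e, Associated q (X ^ m) := by
  apply soloInformed_dvd_X_pow_of_dvd_C_mul_X_pow hc
  rw [← hdet]
  exact dvd_sub (hg.mul_left f) (hk.mul_left h)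

end UFD

section Neighbours

variable {K : Type*} [Field K] {A : Type*} [CommRing A] [Algebra K A]

/-- The `K`-linear "determinant against a fixed row `(f, h)`": `w ↦ f * w 1 - h * w 0`. -/
noncomputable def soloRowDet (f h : A) : (Fin 2 → A) →ₗ[K] A :=
  (LinearMap.mulLeft K f).comp (LinearMap.proj 1) - (LinearMap.mulLeft K h).comp (LinearMap.proj 0)

/-- `soloRowDet f h w = f * w 1 - h * w 0`. -/
@[simp] theorem soloRowDet_apply (f h : A) (w : Fin 2 → A) :
    soloRowDet (K := K) f h w = f * w 1 - h * w 0 := by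
  simp [soloRowDet]

/-- Proposition 7.77(c): columns adjacent to one row along edges with linearly independent values
(`f * g j - h * k j = c j • χ j`, `χ` linearly independent, `c j ≠ 0`) are linearly independent. -/
theorem soloInformed_neighbours_linearIndependent {ι : Type*} (f h : A) (k g : ι → A) (χ : ι → A)
    (hχ : LinearIndependent K χ) (c : ι → K) (hc : ∀ j, c j ≠ 0)
    (hedge : ∀ j, f * g j - h * k j = c j • χ j) :
    LinearIndependent K (fun j => (![k j, g j] : Fin 2 → A)) := by
  have h1 : LinearIndependent K (fun j => c j • χ j) := by
    have := hχ.units_smul (fun j => Units.mk0 (c j) (hc j))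
    convert this using 1
    funext j
    simp [Units.smul_mk0]
  apply LinearIndependent.of_comp (soloRowDet (K := K) f h)
  have h2 : (⇑(soloRowDet (K := K) f h) ∘ fun j => (![k j, g j] : Fin 2 → A)) = fun j => c j • χ j := by
    funext j
    simp [hedge j]
  rw [h2]
  exact h1

/-- The degree bound of Proposition 7.77(c): if moreover all column entries lie in a
finite-dimensional subspace `L'`, at most `2 · finrank K L'` columns are adjacent to one row. -/
theorem soloInformed_neighbours_card_le {ι : Type*} [Fintype ι] (L' : Submodule K A)
    [Module.Finite K L'] (f h : A) (k g : ι → L') (χ : ι → A)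
    (hχ : LinearIndependent K χ) (c : ι → K) (hc : ∀ j, c j ≠ 0)
    (hedge : ∀ j, f * (g j : A) - h * (k j : A) = c j • χ j) :
    Fintype.card ι ≤ 2 * Module.finrank K L' := by
  -- the columns as vectors of `Fin 2 → L'`
  let v : ι → (Fin 2 → L') := fun j => ![k j, g j]
  -- the determinant against the row, on `Fin 2 → L'`
  let D : (Fin 2 → L') →ₗ[K] A :=
    (soloRowDet (K := K) f h).comp (L'.subtype.compLeft (Fin 2))
  have hD : ∀ j, D (v j) = c j • χ j := by
    intro j
    simp [D, v, LinearMap.compLeft, hedge j]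
  have h1 : LinearIndependent K (fun j => c j • χ j) := by
    have := hχ.units_smul (fun j => Units.mk0 (c j) (hc j))
    convert this using 1
    funext j
    simp [Units.smul_mk0]
  have hv : LinearIndependent K v := by
    apply LinearIndependent.of_comp D
    have h2 : (⇑D ∘ v) = fun j => c j • χ j := by
      funext j; exact hD j
    rw [h2]; exact h1
  have hcard := hv.fintype_card_le_finrank
  have hfin : Module.finrank K (Fin 2 → L') = 2 * Module.finrank K L' := by
    rw [Module.finrank_pi_fintype]
    simp [Finset.sum_const, Finset.card_univ, Fintype.card_fin]
  omega

end Neighbours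

end Summit.ValiantsHypothesis.ValiantsHypothesis.Theorems
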